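import Summits.CriticalPhenomena.PercolationContinuityZ3.Theorems.SahiMasterFamilyFInequalityMSTightMain

/-!
# Equality in Marica–Schönheim, V: the characterisation as an `iff`

Support file for the master-family `F`-inequality programme (`prim-master-conj` gen 29; `--supports stmt-CriticalPhenomena-4575`;
memo `run/shared/lean/prim/prim-l12/prim-master-conj/MS-EQUALITY.md` §1).  No definition, no `sorry`, standard axioms.

THEOREM (`card_diffs_eq_card_iff`, new — the kernel form of (TCHAR)).  For a nonempty finite family `F` of finite sets the following
are equivalent:
 (i)  `#(F \\ F) = #F` (equality in Marica–Schönheim);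
 (ii) there is `h ∈ F` such that, writing `U = {f ∩ h : f ∈ F}` and `W = {f \ h : f ∈ F}`,
      (a) `(f ∩ h) ∪ (f' \ h) ∈ F` for all `f, f' ∈ F`            — `F ≅ U × W` is the product of its traces inside/outside `h`;
      (b) `(f \ f') \ h ∈ W` for all `f, f' ∈ F`                  — `W` is closed under differences (a "blown-up down-set");
      (c) `h \ (f \ f') ∈ U` for all `f, f' ∈ F`                  — the differences of `U` are the complements in `h` of members of `U`
                                                                    (`U` is a "blown-up up-set" of `2^h`).
Also `diffs_diffs_subset_diffs_of_card_diffs_eq_card`: for tight `F` the family `F \\ F` is closed under `\` (and `∩`).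
(i) ⟹ (ii) is parts II–IV (`exists_pivot_of_card_diffs_eq_card` and the membership tests); (ii) ⟹ (i): every difference
`e = f \ f'` is `(h \ u) ∪ w` with `u = h \ e ∈ U`, `w = e \ h ∈ W`, so `#(F \\ F) ≤ #U · #W ≤ #F` (the map `(u, w) ↦ u ∪ w` is injective
into `F` by (a)), and Marica–Schönheim gives the reverse inequality.  In words: **a family attains equality in `#F ≤ #(F \\ F)` iff it is
`{g ∪ u ∪ w : u ∈ U, w ∈ W}` for a set `g`, a family `U` on a set `T₁` whose difference family is `{T₁ \ u}`, and a difference-closed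
family `W` on a set `T₂`, with `g, T₁, T₂` pairwise disjoint** (take `g = ⋂ F ⊆ h`, `T₁ = h \ g`, `T₂ = ⋃ F \ h`).

HONEST FRAMING: we could not find this characterisation in print (Ahlswede–Blinovsky, Lectures on Advances in Combinatorics, p. 225,
list it as a research problem "started" by Aharoni–Holzman 1993); [this work].
-/

namespace Summit.CriticalPhenomena.PercolationContinuityZ3.Theorems

namespace TwistedAD

open Finset
open scoped FinsetFamily

variable {α : Type*} [DecidableEq α]

/-- (ii) ⟹ (i): a product family whose outside traces are difference-closed and whose inside traces have complementary differences
is tight.  (Neither `h ∈ F` nor nonemptiness is needed for this direction.) [this work] -/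
theorem card_diffs_eq_card_of_product (F : Finset (Finset α)) (h : Finset α)
    (hprod : ∀ f ∈ F, ∀ f' ∈ F, (f ∩ h) ∪ (f' \ h) ∈ F)
    (hW : ∀ f ∈ F, ∀ f' ∈ F, (f \ f') \ h ∈ F.image (fun g => g \ h))
    (hU : ∀ f ∈ F, ∀ f' ∈ F, h \ (f \ f') ∈ F.image (fun g => g ∩ h)) :
    #(F \\ F) = #F := by
  set U := F.image (fun g => g ∩ h) with hUdef
  set W := F.image (fun g => g \ h) with hWdef
  refine le_antisymm ?_ F.card_le_card_diffs
  -- `#(U ×ˢ W) ≤ #F` via `(u, w) ↦ u ∪ w`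
  have hUW : #(U ×ˢ W) ≤ #F := by
    refine card_le_card_of_injOn (fun uw => uw.1 ∪ uw.2) ?_ ?_
    · intro uw huw
      rw [mem_coe, mem_product, hUdef, hWdef, mem_image, mem_image] at huw
      obtain ⟨⟨f, hf, hfu⟩, ⟨f', hf', hf'w⟩⟩ := huw
      show uw.1 ∪ uw.2 ∈ ((F : Finset (Finset α)) : Set (Finset α))
      rw [mem_coe, ← hfu, ← hf'w]
      exact hprod f hf f' hf'
    · intro uw huw uw' huw' heq
      rw [mem_coe, mem_product, hUdef, hWdef, mem_image, mem_image] at huw huw'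
      obtain ⟨⟨f, -, hfu⟩, ⟨f', -, hf'w⟩⟩ := huw
      obtain ⟨⟨g, -, hgu⟩, ⟨g', -, hg'w⟩⟩ := huw'
      have h1 : uw.1 ⊆ h := by rw [← hfu]; exact inter_subset_right
      have h1' : uw'.1 ⊆ h := by rw [← hgu]; exact inter_subset_right
      have h2 : Disjoint uw.2 h := by rw [← hf'w]; exact sdiff_disjoint
      have h2' : Disjoint uw'.2 h := by rw [← hg'w]; exact sdiff_disjoint
      have heq' : uw.1 ∪ uw.2 = uw'.1 ∪ uw'.2 := heq
      refine Prod.ext ?_ ?_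
      · have : (uw.1 ∪ uw.2) ∩ h = (uw'.1 ∪ uw'.2) ∩ h := by rw [heq']
        rwa [union_inter_eq_left_of h1 h2, union_inter_eq_left_of h1' h2'] at this
      · have : (uw.1 ∪ uw.2) \ h = (uw'.1 ∪ uw'.2) \ h := by rw [heq']
        rwa [union_sdiff_eq_right_of h1 h2, union_sdiff_eq_right_of h1' h2'] at this
  -- `#(F \\ F) ≤ #(U ×ˢ W)` via `e ↦ (h \ e, e \ h)`
  have hDUW : #(F \\ F) ≤ #(U ×ˢ W) := by
    refine card_le_card_of_injOn (fun e => (h \ e, e \ h)) ?_ ?_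
    · intro e he
      rw [mem_coe, mem_diffs] at he
      obtain ⟨f, hf, f', hf', rfl⟩ := he
      show (h \ (f \ f'), (f \ f') \ h) ∈ ((U ×ˢ W : Finset _) : Set _)
      rw [mem_coe, mem_product]
      exact ⟨hU f hf f' hf', hW f hf f' hf'⟩
    · intro e _ e' _ hee
      obtain ⟨e1, e2⟩ := Prod.mk.inj hee
      refine eq_of_inter_eq_of_sdiff_eq ?_ e2
      rw [← sdiff_sdiff_self_eq_inter e h, ← sdiff_sdiff_self_eq_inter e' h, e1]
  exact hDUW.trans hUW

/-- **Equality in Marica–Schönheim — the characterisation.**  A nonempty finite family `F` of finite sets has `#(F \\ F) = #F` iff some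
`h ∈ F` makes `F` the product of its traces `{f ∩ h}`, `{f \ h}` with the outside traces closed under differences and the inside traces
closed under `(u, u') ↦ h \ (u \ u')`. [this work] -/
theorem card_diffs_eq_card_iff (F : Finset (Finset α)) (hne : F.Nonempty) :
    #(F \\ F) = #F ↔ ∃ h ∈ F, (∀ f ∈ F, ∀ f' ∈ F, (f ∩ h) ∪ (f' \ h) ∈ F) ∧
      (∀ f ∈ F, ∀ f' ∈ F, (f \ f') \ h ∈ F.image (fun g => g \ h)) ∧
      (∀ f ∈ F, ∀ f' ∈ F, h \ (f \ f') ∈ F.image (fun g => g ∩ h)) := by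
  constructor
  · intro htight
    obtain ⟨h, hh, hpiv⟩ := exists_pivot_of_card_diffs_eq_card F htight hne
    refine ⟨h, hh, fun f hf f' hf' => union_sdiff_mem_of_pivot F htight h hpiv hf hf', fun f hf f' hf' => ?_,
      fun f hf f' hf' => ?_⟩
    · exact sdiff_mem_image_of_mem_diffs F htight h hpiv (mem_diffs.2 ⟨f, hf, f', hf', rfl⟩)
    · exact inter_mem_image_of_mem_diffs F htight h hpiv (mem_diffs.2 ⟨f, hf, f', hf', rfl⟩)
  · rintro ⟨h, -, hprod, hW, hU⟩
    exact card_diffs_eq_card_of_product F h hprod hW hU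

/-! ### Consequence: the difference family of a tight family is itself closed under differences -/

/-- **For a Marica–Schönheim-tight family the difference family is closed under set difference**: if `#(F \\ F) = #F` then
`(F \\ F) \\ (F \\ F) ⊆ F \\ F` (so `F \\ F` is a "blown-up down-set", in particular closed under intersections).  With a pivot `h`:
`((h \ f₁) ∪ (f₂ \ h)) \ ((h \ g₁) ∪ (g₂ \ h)) = ((g₁ \ f₁) ∩ h) ∪ ((f₂ \ g₂) \ h)`, and both parts are again traces of differences.
[this work] -/
theorem diffs_diffs_subset_diffs_of_card_diffs_eq_card (F : Finset (Finset α)) (htight : #(F \\ F) = #F) :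
    (F \\ F) \\ (F \\ F) ⊆ F \\ F := by
  rcases F.eq_empty_or_nonempty with hF | hne
  · subst hF; simp
  obtain ⟨h, hh, hpiv⟩ := exists_pivot_of_card_diffs_eq_card F htight hne
  intro d hd
  obtain ⟨e, he, e', he', rfl⟩ := mem_diffs.1 hd
  obtain ⟨f₁, hf₁, f₂, hf₂, rfl⟩ := exists_eq_union_of_mem_diffs_of_pivot F htight h hpiv he
  obtain ⟨g₁, hg₁, g₂, hg₂, rfl⟩ := exists_eq_union_of_mem_diffs_of_pivot F htight h hpiv he'
  -- the inside-`h` part is `h \ g` and the outside part is `g' \ h` for suitable members `g, g'`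
  have h1 : h \ (g₁ \ f₁) ∈ F.image (fun g => g ∩ h) :=
    inter_mem_image_of_mem_diffs F htight h hpiv (mem_diffs.2 ⟨g₁, hg₁, f₁, hf₁, rfl⟩)
  have h2 : (f₂ \ g₂) \ h ∈ F.image (fun g => g \ h) :=
    sdiff_mem_image_of_mem_diffs F htight h hpiv (mem_diffs.2 ⟨f₂, hf₂, g₂, hg₂, rfl⟩)
  rw [mem_image] at h1 h2
  obtain ⟨g, hg, hgeq⟩ := h1
  obtain ⟨g', hg', hg'eq⟩ := h2
  have key : ((h \ f₁) ∪ (f₂ \ h)) \ ((h \ g₁) ∪ (g₂ \ h)) = (h \ g) ∪ (g' \ h) := by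
    rw [hg'eq]
    have hin : (g₁ \ f₁) ∩ h = h \ g := by
      have hg' : h \ (g ∩ h) = h \ g := sdiff_inter_self_right h g
      rw [← hg', hgeq, sdiff_sdiff_self_left, inter_comm]
    rw [← hin]
    ext x
    simp only [mem_sdiff, mem_union, mem_inter]
    tauto
  rw [key]
  exact sdiff_union_sdiff_mem_diffs_of_pivot F h hpiv hg hg'

/-- Hence the difference family of a tight family is closed under intersection (`d ∩ d' = d \ (d \ d')`). [this work] -/
theorem inter_mem_diffs_of_card_diffs_eq_card (F : Finset (Finset α)) (htight : #(F \\ F) = #F)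
    {d d' : Finset α} (hd : d ∈ F \\ F) (hd' : d' ∈ F \\ F) : d ∩ d' ∈ F \\ F := by
  have h1 : d \ d' ∈ F \\ F := diffs_diffs_subset_diffs_of_card_diffs_eq_card F htight (mem_diffs.2 ⟨d, hd, d', hd', rfl⟩)
  have h2 : d \ (d \ d') ∈ F \\ F := diffs_diffs_subset_diffs_of_card_diffs_eq_card F htight (mem_diffs.2 ⟨d, hd, _, h1, rfl⟩)
  rwa [sdiff_sdiff_self_left] at h2

end TwistedAD

end Summit.CriticalPhenomena.PercolationContinuityZ3.Theorems
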